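import Summits.QuantumFields.BalabanUV.Beta.WardLocusParitySplit
import Summits.QuantumFields.BalabanUV.Beta.GAN24.SecondOrderReadersParity

/-!
# `BalabanUV.Beta.GAN24.BiTableParityHalves` — row G-an2-4, W-slot EXIT (α-0) (RULING R-gan24p1-g33-1-A1 (6), the (α-END) decomposition, piece (α-END-b)):
# THE PARITY HALVES OF A BI-TABLE KEEP ITS `LocStencil₂` CLASS AND ITS JOINT BLOCK COVARIANCE (OWNER gan24-p1, gen 33)

HONEST DEPENDENCY (page 1, mandatory): continuum YM on T⁴ ⇐ BetaPertH ∧ nine spine estimates (0/9 proved); BetaPertH ⇐ (D1) ∧ (D4) ∧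
CAP+tail; G-an2-4 gates asym, D1 and NE2/3/4.  HONEST FRAMING (cell contract, verbatim): «discharging `BetaPertH` makes Bałaban's UV
stability UNCONDITIONAL — a real constructive-QFT result; it is NOT the continuum limit and NOT the Clay problem.»  [folklore] entrywise bookkeeping
BY NAME over d1-leaf-06's `WardLocusParitySplit.biLoc_oddHalf` pattern; no `def`, no `Prop` minted, nothing printed asserted, 0 sorry; discharges NOTHING
of the wall; NEVER «G-an2-4 closed» as (CONV-C); NOT D1, NOT `BetaPertH`, NOT continuum, NOT Clay.  Nothing is cited here.

## Why (context only)
The (α-END) «T2Shape^{ev}» (journal A-1 [GAN24P1-G33-INTENT3-A1]) instantiates p2's `T2HybridShapeEnd.shape_three_of_hyb_rows` on the parity-EVEN halves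
`T^{ev} := ½•(T + sgnK∘trK∘T)` of the comb member, its sources and cells.  That END reads three rows of every source: a `LocStencil₂` class (`hb`), joint
block-translation covariance and a symmetrised zero-mode condition (`hZ`).  This file supplies the first two for the halves of ANY bi-table, with the
SAME constants: the involution `P := sgnK ∘ trK` costs nothing in the `LocStencil₂` class (both kernel legs are localised at the same point) and
commutes with the block shifts.  (The zero-mode row needs a summable exchange of the two kernel sums and is left to the typists of (α-END-b).)

## What is proved (generic `d`)
* §1 `sgnK_trK_apply`; `shiftK_sgnK_trK` (`shiftK v (sgnK (trK X)) = sgnK (trK (shiftK v X))`); the involution's linearity is leaf-03 g65's `SecondOrderReadersParity.sgnK_trK_add ∕ _smul` (imported, not restated).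
* §2 **`biLoc_sgnK_trK_diag`** (`BiLoc X p p C δ → BiLoc (sgnK (trK X)) p p C δ`), **`biLoc_half`** (`BiLoc X p p C δ → BiLoc (½•(X + ε•sgnK (trK X))) p p C δ` for
  `|ε| ≤ 1`), **`locStencil₂_sgnK_trK`**, **`locStencil₂_half`** — the halves of a `LocStencil₂ S₂ C δ` bi-table are `LocStencil₂ … C δ` with the SAME `C δ`.
* §3 **`covariant_sgnK_trK`**, **`covariant_half`** — joint block-translation covariance `T κ (u+N•t) κ′ (u′+N•t) = shiftK (−N•t) (T κ u κ′ u′)` passes to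
  `P∘T` and to the halves.
Unit `b2b-balaban-gan24-p1` (gen 33), road CT-ROUTE ∕ CT-W of row G-an2-4; no existing file touched.
-/

noncomputable section

open Literature.MathematicalPhysics.QuantumFieldTheory
open Literature.MathematicalPhysics.QuantumFieldTheory.Balaban1983to89
open Literature.MathematicalPhysics.QuantumFieldTheory.Balaban1983to89.Beta
open B12Sec2to5 (l1)
open ExpKernelCalculus (MKer BiLoc shiftK)
open OneStepResolventKernel (Fib)
open BalabanCompositeJets (LocStencil₂)
open Summit.QuantumFields.BalabanUV.Beta.TameKernelCalculus (trK trK_apply)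
open Summit.QuantumFields.BalabanUV.Beta.BorderedHessian (sgnF sgnK sgnK_apply)

namespace Summit.QuantumFields.BalabanUV.Beta.GAN24.BiTableParityHalves

variable {d : ℕ}

/-! ## §1 The involution `sgnK ∘ trK`: entries and shifts (linearity: leaf-03's `SecondOrderReadersParity`) -/

/-- [folklore] Entries of `sgnK (trK X)`. -/
theorem sgnK_trK_apply (X : MKer (d + 1) (Fib d)) (x z : Fin (d + 1) → ℤ) (a b : Fib d) :
    sgnK (trK X) x z a b = sgnF a * sgnF b * X z x b a := rfl

/-- [folklore] `|sgnF a · sgnF b| = 1`. -/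
theorem abs_sgnF_mul_sgnF (a b : Fib d) : |sgnF a * sgnF b| = 1 := by
  have ha : |sgnF (d := d) a| = 1 := by rcases a with κ | κ <;> simp
  have hb : |sgnF (d := d) b| = 1 := by rcases b with κ | κ <;> simp
  rw [abs_mul, ha, hb, mul_one]

/-- [folklore] **THE INVOLUTION COMMUTES WITH THE BLOCK SHIFTS**: `shiftK v (sgnK (trK X)) = sgnK (trK (shiftK v X))`. -/
theorem shiftK_sgnK_trK (v : Fin (d + 1) → ℤ) (X : MKer (d + 1) (Fib d)) : shiftK v (sgnK (trK X)) = sgnK (trK (shiftK v X)) := rfl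

/-! ## §2 The `LocStencil₂` class of the halves -/

/-- [folklore] **A DIAGONALLY BI-LOCALISED KERNEL STAYS SO UNDER `sgnK ∘ trK`, SAME CONSTANTS** (both legs sit at the same point `p`). -/
theorem biLoc_sgnK_trK_diag {X : MKer (d + 1) (Fib d)} {p : Fin (d + 1) → ℤ} {C δ : ℝ} (h : BiLoc X p p C δ) :
    BiLoc (sgnK (trK X)) p p C δ := by
  intro x z a b
  rw [sgnK_trK_apply, abs_mul, abs_sgnF_mul_sgnF, one_mul, add_comm (l1 (x - p))]
  exact h z x b a

/-- [folklore] **THE `ε`-HALF `½•(X + ε•sgnK (trK X))` OF A DIAGONALLY BI-LOCALISED KERNEL IS BI-LOCALISED WITH THE SAME CONSTANTS** (`|ε| ≤ 1`; `ε = 1`: even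
half, `ε = −1`: odd half — d1-leaf-06's `biLoc_oddHalf`). -/
theorem biLoc_half {X : MKer (d + 1) (Fib d)} {p : Fin (d + 1) → ℤ} {C δ : ℝ} (h : BiLoc X p p C δ) {ε : ℝ} (hε : |ε| ≤ 1) :
    BiLoc (((1 : ℝ) / 2) • (X + ε • sgnK (trK X))) p p C δ := by
  intro x z a b
  have h1 := h x z a b
  have h2 := biLoc_sgnK_trK_diag h x z a b
  have hE : 0 ≤ C * Real.exp (-δ * (l1 (x - p) + l1 (z - p))) := (abs_nonneg _).trans h1
  simp only [Pi.smul_apply, Pi.add_apply, smul_eq_mul]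
  rw [abs_mul, abs_of_pos (by norm_num : (0 : ℝ) < 1 / 2)]
  have h3 : |ε * sgnK (trK X) x z a b| ≤ C * Real.exp (-δ * (l1 (x - p) + l1 (z - p))) := by
    rw [abs_mul]
    calc |ε| * |sgnK (trK X) x z a b| ≤ 1 * |sgnK (trK X) x z a b| := mul_le_mul_of_nonneg_right hε (abs_nonneg _)
      _ ≤ _ := by rw [one_mul]; exact h2
  have h4 := abs_add_le (X x z a b) (ε * sgnK (trK X) x z a b)
  nlinarith

/-- [folklore] **`sgnK ∘ trK` PRESERVES THE `LocStencil₂` CLASS WITH THE SAME CONSTANTS.** -/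
theorem locStencil₂_sgnK_trK {S₂ : Fin (d + 1) → (Fin (d + 1) → ℤ) → Fin (d + 1) → (Fin (d + 1) → ℤ) → MKer (d + 1) (Fib d)} {C δ : ℝ}
    (h : LocStencil₂ S₂ C δ) : LocStencil₂ (fun κ u κ' u' => sgnK (trK (S₂ κ u κ' u'))) C δ :=
  fun κ u κ' u' => biLoc_sgnK_trK_diag (h κ u κ' u')

/-- [folklore] **THE PARITY HALVES OF A `LocStencil₂` BI-TABLE ARE `LocStencil₂` WITH THE SAME CONSTANTS** (`|ε| ≤ 1`). -/
theorem locStencil₂_half {S₂ : Fin (d + 1) → (Fin (d + 1) → ℤ) → Fin (d + 1) → (Fin (d + 1) → ℤ) → MKer (d + 1) (Fib d)} {C δ : ℝ}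
    (h : LocStencil₂ S₂ C δ) {ε : ℝ} (hε : |ε| ≤ 1) :
    LocStencil₂ (fun κ u κ' u' => ((1 : ℝ) / 2) • (S₂ κ u κ' u' + ε • sgnK (trK (S₂ κ u κ' u')))) C δ :=
  fun κ u κ' u' => biLoc_half (h κ u κ' u') hε

/-- [folklore] The even half (`ε = 1`). -/
theorem locStencil₂_evenHalf {S₂ : Fin (d + 1) → (Fin (d + 1) → ℤ) → Fin (d + 1) → (Fin (d + 1) → ℤ) → MKer (d + 1) (Fib d)} {C δ : ℝ}
    (h : LocStencil₂ S₂ C δ) :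
    LocStencil₂ (fun κ u κ' u' => ((1 : ℝ) / 2) • (S₂ κ u κ' u' + sgnK (trK (S₂ κ u κ' u')))) C δ := by
  have h1 := locStencil₂_half h (ε := 1) (by norm_num)
  simpa only [one_smul] using h1

/-- [folklore] The odd half (`ε = −1`). -/
theorem locStencil₂_oddHalf {S₂ : Fin (d + 1) → (Fin (d + 1) → ℤ) → Fin (d + 1) → (Fin (d + 1) → ℤ) → MKer (d + 1) (Fib d)} {C δ : ℝ}
    (h : LocStencil₂ S₂ C δ) :
    LocStencil₂ (fun κ u κ' u' => ((1 : ℝ) / 2) • (S₂ κ u κ' u' - sgnK (trK (S₂ κ u κ' u')))) C δ := by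
  have h1 := locStencil₂_half h (ε := -1) (by norm_num)
  simpa only [neg_one_smul, ← sub_eq_add_neg] using h1

/-! ## §3 Joint block-translation covariance of the halves -/

/-- [folklore] **JOINT BLOCK COVARIANCE PASSES TO `sgnK ∘ trK`**: if `T κ (u + N•t) κ′ (u′ + N•t) = shiftK (−N•t) (T κ u κ′ u′)` for all slots, the same holds
for `κ u κ′ u′ ↦ sgnK (trK (T κ u κ′ u′))`. -/
theorem covariant_sgnK_trK {N : ℕ} {T : Fin (d + 1) → (Fin (d + 1) → ℤ) → Fin (d + 1) → (Fin (d + 1) → ℤ) → MKer (d + 1) (Fib d)}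
    (hT : ∀ κ u κ' u' t, T κ (u + (N : ℤ) • t) κ' (u' + (N : ℤ) • t) = shiftK (-((N : ℤ) • t)) (T κ u κ' u'))
    (κ : Fin (d + 1)) (u : Fin (d + 1) → ℤ) (κ' : Fin (d + 1)) (u' t : Fin (d + 1) → ℤ) :
    sgnK (trK (T κ (u + (N : ℤ) • t) κ' (u' + (N : ℤ) • t))) = shiftK (-((N : ℤ) • t)) (sgnK (trK (T κ u κ' u'))) := by
  rw [hT, shiftK_sgnK_trK]

/-- [folklore] **JOINT BLOCK COVARIANCE PASSES TO THE PARITY HALVES** (any `ε`). -/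
theorem covariant_half {N : ℕ} {T : Fin (d + 1) → (Fin (d + 1) → ℤ) → Fin (d + 1) → (Fin (d + 1) → ℤ) → MKer (d + 1) (Fib d)}
    (hT : ∀ κ u κ' u' t, T κ (u + (N : ℤ) • t) κ' (u' + (N : ℤ) • t) = shiftK (-((N : ℤ) • t)) (T κ u κ' u')) (ε : ℝ)
    (κ : Fin (d + 1)) (u : Fin (d + 1) → ℤ) (κ' : Fin (d + 1)) (u' t : Fin (d + 1) → ℤ) :
    ((1 : ℝ) / 2) • (T κ (u + (N : ℤ) • t) κ' (u' + (N : ℤ) • t) + ε • sgnK (trK (T κ (u + (N : ℤ) • t) κ' (u' + (N : ℤ) • t))))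
      = shiftK (-((N : ℤ) • t)) (((1 : ℝ) / 2) • (T κ u κ' u' + ε • sgnK (trK (T κ u κ' u')))) := by
  rw [covariant_sgnK_trK hT, hT]
  rfl

end Summit.QuantumFields.BalabanUV.Beta.GAN24.BiTableParityHalves

end
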